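import Summits.BirchSwinnertonDyer.BirchSwinnertonDyer.Theorems.KolyvaginRankRigidityAtTwoRegularRefillLaw
import HarnessLib

/-!
# Crux U1 `KolyvaginBoundedDefectAtTwo` (stmt-BirchSwinnertonDyer-28083), LINE 17 `regular_core_rigidity` v3,
# stub S1b `stub_nearCoreExistenceAtTwo` — the REFILL LAW WITHOUT CO-CYCLICITY: at a Lagrangian step whose cut
# `A = X ∩ H_f` is co-cyclic only UP TO `2^j` (`2^j H_f ⊆ A + ℤe`), the refill `B = X ∩ H_tr` still has
# `#ann_{H_tr}(A) ≤ #H_tr[2^(j+1)] · #H_f[2^j] · #B` — bounded loss `4j + 2` bits, uniformly in the level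

Width seat `bsd-line-krr2-p2` g14 (ONE READER on S1b); `--supports stmt-BirchSwinnertonDyer-28083` (helper). THEOREMS
ONLY; nothing here proves S1b, U1, a rung or BSD. BSD is NOT proved.

## Why
g13's refill law (`two_nsmul_mem_of_lagrangian_of_cyclic`, `lozenge_refill`, p671760; in situ p672833/p674377/p678125)
needs the cut to be CO-CYCLIC (`H_f = A + ℤe`): at a regular Kolyvagin prime this is a pure-sign step cut by an
eigenclass whose localisation has EXACT order `2^k`. Along the walk of S1b (reader report S1-READER-g14 §4) the
available cutters are refill classes of earlier steps, of local order `2^(k−j)` only (`j` bounded by the number of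
steps): then `H_f/A ≅ ℤ/2^k ⊕ ℤ/2^j` is cyclic only up to `2^j`. This file proves the law in that generality, with a
loss of `#H_tr[2^(j+1)] · #H_f[2^j]` (`= 4^(2j+1)` on `H¹_f(K_λ, E[2^k]) ≅ (ℤ/2^k)²`) in place of `2` — still
independent of the level `k`, which is all the walk's uniform error `κ` needs.

## What (abstract finite-group algebra in g13's setting; all PROVED, no definition, no named fact, no `sorry`)
Setting (as `…RegularRefillLagrangianPair`): `L` finite `n`-torsion, `b : L × L → ℤ/n` symmetric non-degenerate,
`H_f ⊓ H_tr = ⊥`, `H_f ⊔ H_tr = ⊤`, both isotropic; `X` isotropic with `#X = #H_f`; `A = X ∩ H_f`, `B = X ∩ H_tr`,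
`C = ann_{H_tr}(A)`; `e ∈ H_f` with `2^j f − k e ∈ X` for every `f ∈ H_f` and some `k = k(f)`.
* `nsmul_eq_zero_of_mem_ann_of_apply_eq_zero` — `s ∈ C`, `⟨e, s⟩ = 0 ⟹ 2^j s = 0`;
* `exists_generator_nsmul_ann` — `2^j C ⊆ ℤ·(2^j g)` for some `g ∈ C` (`⟨e, ·⟩(C) ≤ ℤ/n` is cyclic);
* `apply_nsmul_eq_zero_of_lifts` — the CORE: for lifts `x_c, x_s ∈ X` of `c, s ∈ C` (graph lemma p671017),
  `⟨x_c − c, 2^(2j+1) s⟩ = 0` (antisymmetry of `(c, s) ↦ ⟨x_c − c, s⟩` from the isotropy of `X`, and `2β(g,g) = 0`);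
* **`natCard_ann_le_of_cyclic_upTo`** — `#C ≤ m₂ · m₁ · #B` whenever `#(H_tr ∩ ker 2^(j+1)) ≤ m₂` and
  `#(H_f ∩ ker 2^j) ≤ m₁`: `2^(j+1) C ⊆ (X + U) ∩ H_tr` with `U = {f ∈ H_f : 2^j f ∈ A}`, `#U ≤ m₁ #A`, and
  `(X + U) ∩ H_tr → (X + U)/X` has kernel `B`;
* **`lozenge_refill_of_cyclic_upTo`** — walk form: `#S · #H_f ≤ m₂ · m₁ · #loc(S)² · #S'` (`S = Rel ∩ loc⁻¹H_f`,
  `S' = Rel ∩ loc⁻¹H_tr`, `X = loc(Rel)`), the companion of `lozenge_refill` (which is the case `j = 0`, constant 2).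
References (locators only; no cited FACT is declared): [cite: MazurRubin2004, Prop. 1.3.2, Thm. 2.3.4, §4.1]
[cite: Howard2004HeegnerKolyvagin, Thm. 2.1.11] [cite: Jetchev2008, Lemma 5.2, §5.2] [cite: MilneADT2006, Ch. I §0 (0.19)].
Design: no definitions; `Type*`-polymorphic; `Nat.card`; axioms `propext`, `Classical.choice`, `Quot.sound`.
-/

set_option autoImplicit false
-- the Theorems namespace of this sub repeats the summit name by design (D-0017 nested layout)
set_option linter.dupNamespace false

noncomputable section

open scoped Classical
open Function

namespace Summit.BirchSwinnertonDyer.BirchSwinnertonDyer.Theorems.KolyvaginAtTwo.RegularRefill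

open Summit.BirchSwinnertonDyer.Rank1Residual.JET.Section6 (card_eq_card_inf_ker_mul_card_map)

variable {L : Type*} [AddCommGroup L]

section Lagrangian

variable {n : ℕ} (b : L →+ L →+ ZMod n)
  (hn : ∀ x : L, n • x = 0) (hsymm : ∀ x y, b x y = b y x)
  {Hf Htr : AddSubgroup L} (hdisj : Hf ⊓ Htr = ⊥) (hcod : Hf ⊔ Htr = ⊤)
  (hHf : ∀ x ∈ Hf, ∀ y ∈ Hf, b x y = 0) (hHtr : ∀ x ∈ Htr, ∀ y ∈ Htr, b x y = 0)

/-! ### §1 The cut co-cyclic up to `2^j`: the character `⟨e, ·⟩` on `C = ann_{H_tr}(A)` -/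

include hsymm hcod hHtr in
/-- If `2^j H_f ⊆ (X ∩ H_f) + ℤe` (`e ∈ H_f`) then an element of `C = ann_{H_tr}(X ∩ H_f)` pairing to zero with `e` is
killed by `2^j`: it pairs to zero with `2^j H_f`, so `2^j` times it pairs to zero with `H_f`. [folklore] -/
theorem nsmul_eq_zero_of_mem_ann_of_apply_eq_zero (hinj : Injective b) (X : AddSubgroup L) (j : ℕ)
    {e : L} (he : e ∈ Hf) (hcyc : ∀ f ∈ Hf, ∃ k : ℤ, (2 ^ j) • f - k • e ∈ X)
    {s : L} (hs : s ∈ (Htr ⊓ ⨅ a ∈ X ⊓ Hf, (b a).ker : AddSubgroup L)) (hes : b e s = 0) :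
    (2 ^ j) • s = 0 := by
  obtain ⟨hsT, hsann⟩ := (mem_inf_iInf_ker_iff b Htr (X ⊓ Hf) s).mp hs
  refine eq_zero_of_mem_of_forall_mem' b hsymm hcod hHtr hinj (Htr.nsmul_mem hsT _) fun f hf ↦ ?_
  obtain ⟨k, hk⟩ := hcyc f hf
  have ha : (2 ^ j) • f - k • e ∈ X ⊓ Hf :=
    AddSubgroup.mem_inf.mpr ⟨hk, Hf.sub_mem (Hf.nsmul_mem hf _) (Hf.zsmul_mem he k)⟩
  have h1 : b ((2 ^ j) • f - k • e) s = 0 := hsann _ ha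
  rw [map_sub, map_nsmul, map_zsmul, AddMonoidHom.sub_apply, AddMonoidHom.nsmul_apply,
    AddMonoidHom.zsmul_apply, hes, smul_zero, sub_zero] at h1
  rw [map_nsmul]
  exact h1

include hsymm hcod hHtr in
/-- **`2^j C` is cyclic**: for some `g ∈ C = ann_{H_tr}(X ∩ H_f)`, every `c ∈ C` has `2^j c ∈ ℤ · 2^j g` (the image of
`⟨e, ·⟩` on `C` is a subgroup of the cyclic group `ℤ/n`, and its kernel on `C` is killed by `2^j`). [folklore] -/
theorem exists_generator_nsmul_ann (hinj : Injective b) (X : AddSubgroup L) (j : ℕ)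
    {e : L} (he : e ∈ Hf) (hcyc : ∀ f ∈ Hf, ∃ k : ℤ, (2 ^ j) • f - k • e ∈ X) :
    ∃ g ∈ (Htr ⊓ ⨅ a ∈ X ⊓ Hf, (b a).ker : AddSubgroup L),
      ∀ c ∈ (Htr ⊓ ⨅ a ∈ X ⊓ Hf, (b a).ker : AddSubgroup L), ∃ m : ℤ, (2 ^ j) • c = m • ((2 ^ j) • g) := by
  set C : AddSubgroup L := Htr ⊓ ⨅ a ∈ X ⊓ Hf, (b a).ker with hC
  set χ : C →+ ZMod n := (b e).comp C.subtype with hχ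
  have hχ_apply : ∀ c : C, χ c = b e c := fun _ ↦ rfl
  haveI : IsAddCyclic χ.range := inferInstance
  obtain ⟨γ, hγ⟩ := IsAddCyclic.exists_generator (α := χ.range)
  obtain ⟨g₀, hg₀⟩ := (AddMonoidHom.mem_range).mp γ.2
  refine ⟨g₀, g₀.2, fun c hc ↦ ?_⟩
  have hmem : (⟨χ ⟨c, hc⟩, ⟨⟨c, hc⟩, rfl⟩⟩ : χ.range) ∈ AddSubgroup.zmultiples γ := hγ _
  obtain ⟨m, hm⟩ := AddSubgroup.mem_zmultiples_iff.mp hmem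
  have hm' : m • χ g₀ = χ ⟨c, hc⟩ := by
    have h := congrArg Subtype.val hm
    simp only [AddSubgroupClass.coe_zsmul] at h
    rw [hg₀]
    exact h
  refine ⟨m, ?_⟩
  have h0 : b e (c - m • (g₀ : L)) = 0 := by
    rw [map_sub, map_zsmul]
    change χ ⟨c, hc⟩ - m • χ g₀ = 0
    rw [hm', sub_self]
  have h1 := nsmul_eq_zero_of_mem_ann_of_apply_eq_zero b hsymm hcod hHtr hinj X j he hcyc
    (C.sub_mem hc (C.zsmul_mem g₀.2 m)) h0
  rw [smul_sub, sub_eq_zero, smul_comm] at h1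
  exact h1

/-! ### §2 The core: `⟨x_c − c, 2^(2j+1) s⟩ = 0` for lifts of `c, s ∈ C` -/

include hsymm hHf hHtr in
/-- **Antisymmetry of `(c, s) ↦ ⟨x_c − c, s⟩` on `C`** for lifts `x_c, x_s ∈ X` with `x_c − c, x_s − s ∈ H_f` of elements
`c, s ∈ H_tr`: from the isotropy of `X`, `H_f`, `H_tr` and the SYMMETRY of `b` (this is where the local cup product at
`2` being symmetric, not alternating, enters). [cite: MazurRubin2004, Prop. 1.3.2] -/
theorem apply_add_apply_eq_zero_of_lifts (X : AddSubgroup L) (hX : ∀ x ∈ X, ∀ y ∈ X, b x y = 0)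
    {c s xc xs : L} (hc : c ∈ Htr) (hs : s ∈ Htr) (hxc : xc ∈ X) (hxs : xs ∈ X)
    (hfc : xc - c ∈ Hf) (hfs : xs - s ∈ Hf) :
    b (xc - c) s + b (xs - s) c = 0 := by
  have h := hX xc hxc xs hxs
  have h1 : b (xc - c) (xs - s) = 0 := hHf _ hfc _ hfs
  have h2 : b c s = 0 := hHtr _ hc _ hs
  have h3 : b c (xs - s) = b (xs - s) c := hsymm _ _
  have e1 : xc = (xc - c) + c := by abel
  have e2 : xs = (xs - s) + s := by abel
  rw [e1, e2] at h
  simp only [map_add, AddMonoidHom.add_apply, h1, h2, h3, zero_add, add_zero] at h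
  rw [add_comm] at h
  exact h

include hsymm hcod hHf hHtr in
/-- **THE CORE.** With lifts `x_t ∈ X`, `x_t − t ∈ H_f` chosen for all `t ∈ C` (graph lemma), and the cut co-cyclic up to
`2^j`: `⟨x_c − c, 2^(2j+1) s⟩ = 0` for all `c, s ∈ C`. PROOF: `2^j s = a_s 2^j g`, `2^j c = a_c 2^j g`
(`exists_generator_nsmul_ann`); the `H_f`-parts of the two lifts `2^j x_c`, `a_c 2^j x_g` of `2^j c` differ by an element
of `A`, which pairs to zero with `C`; so `⟨x_c − c, 2^(2j+1) s⟩ = a_s a_c 4^j · 2⟨x_g − g, g⟩ = 0` by antisymmetry.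
[cite: MazurRubin2004, Prop. 1.3.2, §4.1] -/
theorem apply_nsmul_eq_zero_of_lifts (hinj : Injective b) (X : AddSubgroup L)
    (hX : ∀ x ∈ X, ∀ y ∈ X, b x y = 0) (j : ℕ)
    {e : L} (he : e ∈ Hf) (hcyc : ∀ f ∈ Hf, ∃ k : ℤ, (2 ^ j) • f - k • e ∈ X)
    {xl : L → L} (hxlX : ∀ t ∈ (Htr ⊓ ⨅ a ∈ X ⊓ Hf, (b a).ker : AddSubgroup L), xl t ∈ X)
    (hxlf : ∀ t ∈ (Htr ⊓ ⨅ a ∈ X ⊓ Hf, (b a).ker : AddSubgroup L), xl t - t ∈ Hf)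
    {c s : L} (hc : c ∈ (Htr ⊓ ⨅ a ∈ X ⊓ Hf, (b a).ker : AddSubgroup L))
    (hs : s ∈ (Htr ⊓ ⨅ a ∈ X ⊓ Hf, (b a).ker : AddSubgroup L)) :
    b (xl c - c) ((2 ^ (2 * j + 1)) • s) = 0 := by
  set A : AddSubgroup L := X ⊓ Hf with hAdef
  set C : AddSubgroup L := Htr ⊓ ⨅ a ∈ A, (b a).ker with hC
  have hCT : ∀ t ∈ C, t ∈ Htr := fun t ht ↦ (AddSubgroup.mem_inf.mp ht).1
  have hCann : ∀ t ∈ C, ∀ a ∈ A, b a t = 0 := fun t ht ↦ ((mem_inf_iInf_ker_iff b Htr A t).mp ht).2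
  obtain ⟨g, hg, hgen⟩ := exists_generator_nsmul_ann b hsymm hcod hHtr hinj X j he hcyc
  obtain ⟨ac, hac⟩ := hgen c hc
  obtain ⟨as, has⟩ := hgen s hs
  -- the `A`-difference of the two lifts of `2^j c`
  have hd : (2 ^ j) • (xl c - c) - ac • ((2 ^ j) • (xl g - g)) ∈ A := by
    have hrw : (2 ^ j) • (xl c - c) - ac • ((2 ^ j) • (xl g - g)) =
        ((2 ^ j) • xl c - ac • ((2 ^ j) • xl g)) - ((2 ^ j) • c - ac • ((2 ^ j) • g)) := by
      simp only [smul_sub]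
      abel
    refine AddSubgroup.mem_inf.mpr ⟨?_, Hf.sub_mem (Hf.nsmul_mem (hxlf c hc) _)
      (Hf.zsmul_mem (Hf.nsmul_mem (hxlf g hg) _) ac)⟩
    rw [hrw, hac, sub_self, sub_zero]
    exact X.sub_mem (X.nsmul_mem (hxlX c hc) _) (X.zsmul_mem (X.nsmul_mem (hxlX g hg) _) ac)
  -- (*) `2^j ⟨x_c − c, t⟩ = a_c 2^j ⟨x_g − g, t⟩` on `C`
  have hstar : ∀ t ∈ C, (2 ^ j) • b (xl c - c) t = ac • ((2 ^ j) • b (xl g - g) t) := fun t ht ↦ by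
    have h0 : b ((2 ^ j) • (xl c - c) - ac • ((2 ^ j) • (xl g - g))) t = 0 := hCann t ht _ hd
    rw [map_sub, map_zsmul, map_nsmul, map_nsmul, AddMonoidHom.sub_apply, AddMonoidHom.zsmul_apply,
      AddMonoidHom.nsmul_apply, AddMonoidHom.nsmul_apply, sub_eq_zero] at h0
    exact h0
  -- antisymmetry at `(g, g)`: `2 ⟨x_g − g, g⟩ = 0`
  have h2g : (2 : ZMod n) * b (xl g - g) g = 0 := by
    have h := apply_add_apply_eq_zero_of_lifts b hsymm hHf hHtr X hX (hCT g hg) (hCT g hg) (hxlX g hg) (hxlX g hg)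
      (hxlf g hg) (hxlf g hg)
    rw [← two_mul] at h
    exact h
  -- assemble
  have hpow : (2 ^ (2 * j + 1)) • s = (2 ^ (j + 1)) • ((2 ^ j) • s) := by
    rw [← mul_smul, ← pow_add]; congr 1; ring
  rw [hpow, map_nsmul, has, map_zsmul, map_nsmul, hstar g hg]
  simp only [nsmul_eq_mul, zsmul_eq_mul]
  have hring : ((2 ^ (j + 1) : ℕ) : ZMod n) * ((as : ZMod n) * ((ac : ZMod n) * (((2 ^ j : ℕ) : ZMod n) * b (xl g - g) g))) =
      (as : ZMod n) * (ac : ZMod n) * ((2 ^ j : ℕ) : ZMod n) * ((2 ^ j : ℕ) : ZMod n) * ((2 : ZMod n) * b (xl g - g) g) := by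
    push_cast
    ring
  rw [hring, h2g, mul_zero]

/-! ### §3 The count `#C ≤ m₂ · m₁ · #B` -/

include hn hsymm hdisj hcod hHf hHtr in
/-- **REFILL LAW WITHOUT CO-CYCLICITY.** `b` symmetric non-degenerate on the finite `n`-torsion group `L = H_f ⊕ H_tr`
(both isotropic), `X` isotropic with `#X = #H_f`, `A = X ∩ H_f`, `B = X ∩ H_tr`, `C = ann_{H_tr}(A)`, and the cut
co-cyclic UP TO `2^j`: `2^j f − k e ∈ X` for every `f ∈ H_f` (`e ∈ H_f`). If the `2^j`-torsion of `H_f` has at most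
`m₁` elements and the `2^(j+1)`-torsion of `H_tr` at most `m₂`, then **`#C ≤ m₂ · m₁ · #B`**. PROOF:
`2^(j+1) C ⊆ (X + U) ∩ H_tr` with `U = {f ∈ H_f : 2^j f ∈ A}` (the core `apply_nsmul_eq_zero_of_lifts` + double
annihilator), `#U ≤ m₁ · #A`, the projection `(X + U) ∩ H_tr → (X + U)/X ⊆ U/(U ∩ X) = U/A` has kernel `B`, and
`#C ≤ #C[2^(j+1)] · #2^(j+1)C`. The case `j = 0` (constant `2 · 1`... here `m₂ m₁ = #H_tr[2]`) is g13's law up to the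
constant. [cite: MazurRubin2004, Prop. 1.3.2, Thm. 2.3.4, §4.1] [cite: Howard2004HeegnerKolyvagin, Thm. 2.1.11] -/
theorem natCard_ann_le_of_cyclic_upTo [Finite L] [NeZero n] (hinj : Injective b) (X : AddSubgroup L)
    (hX : ∀ x ∈ X, ∀ y ∈ X, b x y = 0) (hcard : Nat.card X = Nat.card Hf) (j : ℕ)
    {e : L} (he : e ∈ Hf) (hcyc : ∀ f ∈ Hf, ∃ k : ℤ, (2 ^ j) • f - k • e ∈ X)
    {m₁ m₂ : ℕ} (hm₁ : Nat.card ↥(Hf ⊓ (nsmulAddMonoidHom (2 ^ j) : L →+ L).ker) ≤ m₁)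
    (hm₂ : Nat.card ↥(Htr ⊓ (nsmulAddMonoidHom (2 ^ (j + 1)) : L →+ L).ker) ≤ m₂) :
    Nat.card ↥(Htr ⊓ ⨅ a ∈ X ⊓ Hf, (b a).ker) ≤ m₂ * m₁ * Nat.card ↥(X ⊓ Htr) := by
  set A : AddSubgroup L := X ⊓ Hf with hAdef
  set C : AddSubgroup L := Htr ⊓ ⨅ a ∈ A, (b a).ker with hC
  set B : AddSubgroup L := X ⊓ Htr with hBdef
  set δ : L →+ L := nsmulAddMonoidHom (2 ^ j) with hδ
  set δ' : L →+ L := nsmulAddMonoidHom (2 ^ (j + 1)) with hδ'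
  have hδ_apply : ∀ x, δ x = (2 ^ j) • x := fun x ↦ rfl
  have hδ'_apply : ∀ x, δ' x = (2 ^ (j + 1)) • x := fun x ↦ rfl
  have hAle : A ≤ Hf := inf_le_right
  have hCT : ∀ t ∈ C, t ∈ Htr := fun t ht ↦ (AddSubgroup.mem_inf.mp ht).1
  have hCann : ∀ t ∈ C, ∀ a ∈ A, b a t = 0 := fun t ht ↦ ((mem_inf_iInf_ker_iff b Htr A t).mp ht).2
  -- lifts (graph lemma)
  have hlift : ∀ t, t ∈ C → ∃ x, x ∈ X ∧ x - t ∈ Hf := fun t ht ↦ by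
    obtain ⟨x, hx, hxt⟩ := exists_mem_sub_mem_of_lagrangian b hn hsymm hdisj hcod hHf hHtr hinj X hX hcard ht
    exact ⟨x, hx, hxt⟩
  choose! xl hxlX hxlf using hlift
  -- `U = {f ∈ H_f : 2^j f ∈ A}`
  set U : AddSubgroup L := Hf ⊓ A.comap δ with hU
  have hAU : A ≤ U := fun a ha ↦ AddSubgroup.mem_inf.mpr ⟨hAle ha, by
    rw [AddSubgroup.mem_comap, hδ_apply]; exact A.nsmul_mem ha _⟩
  have hUX : U ⊓ X = A := by
    apply le_antisymm
    · intro u hu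
      exact AddSubgroup.mem_inf.mpr ⟨(AddSubgroup.mem_inf.mp hu).2, (AddSubgroup.mem_inf.mp (AddSubgroup.mem_inf.mp hu).1).1⟩
    · exact le_inf hAU inf_le_left
  -- `#U ≤ m₁ · #A`
  have hUcard : Nat.card U ≤ m₁ * Nat.card A := by
    rw [card_eq_card_inf_ker_mul_card_map δ U]
    refine Nat.mul_le_mul ((AddSubgroup.card_le_of_le ?_).trans hm₁) (AddSubgroup.card_le_of_le ?_)
    · exact inf_le_inf_right _ inf_le_left
    · rintro _ ⟨u, hu, rfl⟩
      exact AddSubgroup.mem_comap.mp (AddSubgroup.mem_inf.mp hu).2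
  -- `2^(j+1) C ⊆ (X ⊔ U) ⊓ Htr`
  set V : AddSubgroup L := (X ⊔ U) ⊓ Htr with hV
  have hcore : ∀ c ∈ C, (2 ^ (j + 1)) • (xl c - c) ∈ U := fun c hc ↦ by
    refine AddSubgroup.mem_inf.mpr ⟨Hf.nsmul_mem (hxlf c hc) _, ?_⟩
    rw [AddSubgroup.mem_comap, hδ_apply, hAdef,
      ← inf_ann_ann_eq b hn hsymm hcod hHf hHtr hinj (X ⊓ Hf) inf_le_right, mem_inf_iInf_ker_iff]
    refine ⟨Hf.nsmul_mem (Hf.nsmul_mem (hxlf c hc) _) _, fun t ht ↦ ?_⟩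
    rw [hsymm, ← mul_smul, ← pow_add, map_nsmul, AddMonoidHom.nsmul_apply, ← map_nsmul,
      show j + (j + 1) = 2 * j + 1 by ring]
    exact apply_nsmul_eq_zero_of_lifts b hsymm hcod hHf hHtr hinj X hX j he hcyc hxlX hxlf hc ht
  have hCmap : C.map δ' ≤ V := by
    rintro _ ⟨c, hc, rfl⟩
    rw [hδ'_apply]
    refine AddSubgroup.mem_inf.mpr ⟨?_, Htr.nsmul_mem (hCT c hc) _⟩
    have hrw : (2 ^ (j + 1)) • c = (2 ^ (j + 1)) • xl c - (2 ^ (j + 1)) • (xl c - c) := by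
      rw [smul_sub]; abel
    rw [hrw]
    exact AddSubgroup.sub_mem _ (AddSubgroup.mem_sup_left (X.nsmul_mem (hxlX c hc) _))
      (AddSubgroup.mem_sup_right (hcore c hc))
  -- `#V ≤ #B · m₁` through `π : L → L/X`
  set π : L →+ L ⧸ X := QuotientAddGroup.mk' X with hπ
  have hπker : π.ker = X := QuotientAddGroup.ker_mk' X
  have hVker : V ⊓ π.ker ≤ B := by
    rw [hπker]
    intro v hv
    exact AddSubgroup.mem_inf.mpr ⟨(AddSubgroup.mem_inf.mp hv).2, (AddSubgroup.mem_inf.mp (AddSubgroup.mem_inf.mp hv).1).2⟩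
  have hVmap : V.map π ≤ U.map π := by
    rintro _ ⟨v, hv, rfl⟩
    obtain ⟨x, hx, u, hu, hxu⟩ := AddSubgroup.mem_sup.mp (AddSubgroup.mem_inf.mp hv).1
    refine ⟨u, hu, ?_⟩
    have hxk : x ∈ π.ker := by rw [hπker]; exact hx
    rw [← hxu, map_add, (AddMonoidHom.mem_ker).mp hxk, zero_add]
  have hUmap : Nat.card (U.map π) ≤ m₁ := by
    have h := card_eq_card_inf_ker_mul_card_map π U
    rw [hπker, hUX] at h
    have hApos : 0 < Nat.card A := Nat.card_pos
    have h2 : Nat.card A * Nat.card (U.map π) ≤ Nat.card A * m₁ := by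
      rw [← h, mul_comm]; exact hUcard
    exact Nat.le_of_mul_le_mul_left h2 hApos
  have hVcard : Nat.card V ≤ Nat.card B * m₁ := by
    rw [card_eq_card_inf_ker_mul_card_map π V]
    exact Nat.mul_le_mul (AddSubgroup.card_le_of_le hVker) ((AddSubgroup.card_le_of_le hVmap).trans hUmap)
  -- `#C ≤ #C[2^(j+1)] · #2^(j+1)C`
  calc Nat.card C = Nat.card ↥(C ⊓ δ'.ker) * Nat.card (C.map δ') := card_eq_card_inf_ker_mul_card_map δ' C
    _ ≤ m₂ * (Nat.card B * m₁) :=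
        Nat.mul_le_mul ((AddSubgroup.card_le_of_le (inf_le_inf_right _ inf_le_left)).trans hm₂)
          ((AddSubgroup.card_le_of_le hCmap).trans hVcard)
    _ = m₂ * m₁ * Nat.card B := by ring

include hn hsymm hdisj hcod hHf hHtr in
/-- **Counting form: `#H_f ≤ m₂ · m₁ · #(X ∩ H_f) · #(X ∩ H_tr)`** (from `natCard_ann_le_of_cyclic_upTo` and
`#ann_{H_tr}(A) · #A = #H_tr = #H_f`). [cite: MazurRubin2004, Prop. 1.3.2, §4.1] -/
theorem natCard_le_mul_of_cyclic_upTo [Finite L] [NeZero n] (hinj : Injective b) (X : AddSubgroup L)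
    (hX : ∀ x ∈ X, ∀ y ∈ X, b x y = 0) (hcard : Nat.card X = Nat.card Hf) (j : ℕ)
    {e : L} (he : e ∈ Hf) (hcyc : ∀ f ∈ Hf, ∃ k : ℤ, (2 ^ j) • f - k • e ∈ X)
    {m₁ m₂ : ℕ} (hm₁ : Nat.card ↥(Hf ⊓ (nsmulAddMonoidHom (2 ^ j) : L →+ L).ker) ≤ m₁)
    (hm₂ : Nat.card ↥(Htr ⊓ (nsmulAddMonoidHom (2 ^ (j + 1)) : L →+ L).ker) ≤ m₂) :
    Nat.card Hf ≤ m₂ * m₁ * Nat.card ↥(X ⊓ Hf) * Nat.card ↥(X ⊓ Htr) := by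
  have hCA : Nat.card ↥(Htr ⊓ ⨅ a ∈ X ⊓ Hf, (b a).ker) * Nat.card ↥(X ⊓ Hf) = Nat.card Htr :=
    natCard_ann_mul_natCard b hn hsymm hcod hHf hHtr hinj (X ⊓ Hf) inf_le_right
  have hfT : Nat.card Hf = Nat.card Htr := natCard_eq_of_lagrangian_pair b hn hsymm hcod hHf hHtr hinj
  have hC := natCard_ann_le_of_cyclic_upTo b hn hsymm hdisj hcod hHf hHtr hinj X hX hcard j he hcyc hm₁ hm₂
  calc Nat.card Hf = Nat.card ↥(Htr ⊓ ⨅ a ∈ X ⊓ Hf, (b a).ker) * Nat.card ↥(X ⊓ Hf) := by rw [hfT, hCA]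
    _ ≤ m₂ * m₁ * Nat.card ↥(X ⊓ Htr) * Nat.card ↥(X ⊓ Hf) := Nat.mul_le_mul_right _ hC
    _ = m₂ * m₁ * Nat.card ↥(X ⊓ Hf) * Nat.card ↥(X ⊓ Htr) := by ring

/-! ### §4 Walk form -/

include hn hsymm hdisj hcod hHf hHtr in
/-- **LOZENGE REFILL INEQUALITY WITHOUT CO-CYCLICITY** (companion of `lozenge_refill`, the case `j = 0`). For
`loc : G →+ L`, `Rel ≤ G`, `S = Rel ⊓ loc⁻¹(H_f)`, `S' = Rel ⊓ loc⁻¹(H_tr)`, `X = loc(Rel)` isotropic of order `#H_f`,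
and the cut co-cyclic up to `2^j` (`2^j H_f ⊆ loc(S) + ℤe`): `#S · #H_f ≤ m₂ · m₁ · #loc(S)² · #S'`. On
`H¹(K_λ, E[2^k])` at a regular Kolyvagin prime (`m₁ = 4^j`, `m₂ = 4^(j+1)`): a step cut by an eigenclass of local
order `2^(k−j)` loses at most `4j + 2` bits relative to the lossless count. [cite: MazurRubin2004, Prop. 1.3.2, §4.1]
[cite: Jetchev2008, Lemma 5.2, proof of Prop. 5.3] -/
theorem lozenge_refill_of_cyclic_upTo [Finite L] [NeZero n] (hinj : Injective b) {G : Type*} [AddCommGroup G]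
    (loc : G →+ L) (Rel : AddSubgroup G)
    (hX : ∀ x ∈ Rel.map loc, ∀ y ∈ Rel.map loc, b x y = 0) (hcard : Nat.card ↥(Rel.map loc) = Nat.card Hf) (j : ℕ)
    {e : L} (he : e ∈ Hf) (hcyc : ∀ f ∈ Hf, ∃ k : ℤ, (2 ^ j) • f - k • e ∈ Rel.map loc)
    {m₁ m₂ : ℕ} (hm₁ : Nat.card ↥(Hf ⊓ (nsmulAddMonoidHom (2 ^ j) : L →+ L).ker) ≤ m₁)
    (hm₂ : Nat.card ↥(Htr ⊓ (nsmulAddMonoidHom (2 ^ (j + 1)) : L →+ L).ker) ≤ m₂) :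
    Nat.card ↥(Rel ⊓ Hf.comap loc) * Nat.card Hf ≤
      m₂ * m₁ * Nat.card ↥((Rel ⊓ Hf.comap loc).map loc) ^ 2 * Nat.card ↥(Rel ⊓ Htr.comap loc) := by
  set X : AddSubgroup L := Rel.map loc with hXdef
  set S : AddSubgroup G := Rel ⊓ Hf.comap loc with hS
  set S' : AddSubgroup G := Rel ⊓ Htr.comap loc with hS'
  have himS : S.map loc = X ⊓ Hf := by
    ext y
    constructor
    · rintro ⟨s, hs, rfl⟩
      exact AddSubgroup.mem_inf.mpr ⟨⟨s, (AddSubgroup.mem_inf.mp hs).1, rfl⟩,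
        AddSubgroup.mem_comap.mp (AddSubgroup.mem_inf.mp hs).2⟩
    · rintro ⟨⟨s, hs, rfl⟩, hy⟩
      exact ⟨s, AddSubgroup.mem_inf.mpr ⟨hs, AddSubgroup.mem_comap.mpr hy⟩, rfl⟩
  have himS' : S'.map loc = X ⊓ Htr := by
    ext y
    constructor
    · rintro ⟨s, hs, rfl⟩
      exact AddSubgroup.mem_inf.mpr ⟨⟨s, (AddSubgroup.mem_inf.mp hs).1, rfl⟩,
        AddSubgroup.mem_comap.mp (AddSubgroup.mem_inf.mp hs).2⟩
    · rintro ⟨⟨s, hs, rfl⟩, hy⟩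
      exact ⟨s, AddSubgroup.mem_inf.mpr ⟨hs, AddSubgroup.mem_comap.mpr hy⟩, rfl⟩
  have hk : S ⊓ loc.ker = S' ⊓ loc.ker := by
    ext s
    simp only [hS, hS', AddSubgroup.mem_inf, AddSubgroup.mem_comap, AddMonoidHom.mem_ker]
    constructor
    · rintro ⟨⟨hs, -⟩, h0⟩; exact ⟨⟨hs, by rw [h0]; exact Htr.zero_mem⟩, h0⟩
    · rintro ⟨⟨hs, -⟩, h0⟩; exact ⟨⟨hs, by rw [h0]; exact Hf.zero_mem⟩, h0⟩
  have hSc : Nat.card S = Nat.card ↥(S ⊓ loc.ker) * Nat.card ↥(X ⊓ Hf) := by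
    rw [← himS]; exact card_eq_card_inf_ker_mul_card_map loc S
  have hS'c : Nat.card S' = Nat.card ↥(S' ⊓ loc.ker) * Nat.card ↥(X ⊓ Htr) := by
    rw [← himS']; exact card_eq_card_inf_ker_mul_card_map loc S'
  have hmain := natCard_le_mul_of_cyclic_upTo b hn hsymm hdisj hcod hHf hHtr hinj X hX hcard j he hcyc hm₁ hm₂
  rw [himS]
  calc Nat.card S * Nat.card Hf
      ≤ Nat.card S * (m₂ * m₁ * Nat.card ↥(X ⊓ Hf) * Nat.card ↥(X ⊓ Htr)) := Nat.mul_le_mul_left _ hmain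
    _ = m₂ * m₁ * Nat.card ↥(X ⊓ Hf) ^ 2 * (Nat.card ↥(S' ⊓ loc.ker) * Nat.card ↥(X ⊓ Htr)) := by
        rw [hSc, hk]; ring
    _ = m₂ * m₁ * Nat.card ↥(X ⊓ Hf) ^ 2 * Nat.card S' := by rw [← hS'c]

end Lagrangian

end Summit.BirchSwinnertonDyer.BirchSwinnertonDyer.Theorems.KolyvaginAtTwo.RegularRefill

end
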